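import Literature.Computability.Complexity.Transducers
import Mathlib.Tactic.DeriveFintype
import Mathlib.Data.Fintype.Sigma
import Mathlib.Data.Fintype.Sum
import Mathlib.Data.List.Dedup
import HarnessLib

/-!
# Brute-force `k`-SAT, renaming stage: ranking the variables by transducer passes

Trunk `CplxCore` / family `fine-grained`. First of the two finite-state machines of the
brute-force satisfiability decider behind `Literature.Computability.FineGrained.kSATInExpTime_one`
(`k`-SAT ∈ TIME(`2ⁿ · poly(L)`); Impagliazzo–Paturi 2001, §1: `s_k ≤ 1` by exhaustive search).
The decider enumerates the assignments of the `v` *distinct variables occurring in the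
formula* (enumerating all `numVars` variables would cost `numVars · 2^numVars` steps, too much
when the input is short), so the variables — binary numerals of unbounded length — must first
be *ranked* `0, …, v - 1`. This file does the ranking by iterating one finite-state transducer
`renFST` (a pass over the state word; `Transducers.lean`), machine-free: it defines the
transducer and proves what its iterates compute. The companion files are
`SATBruteForceCount.lean` (the counting stage) and `SATBruteForceMachine.lean` (the pipeline).

State word (alphabet `RSym`): a mode symbol, a block of `unit`s (the clock of the next stage,
doubled at every ranking step, so `2^v` at the end), then the clauses `bra … ket`; a literal is
its index bits `ibit chk b` (with a check mark), its cells (`pre`/`mark`/`post`, one per ranking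
step so far) and its head `head st pol` (status and polarity). Ranking step `t` (pivot
variable `b_t` = the variable of the first unranked literal) consists of the passes

* `sel`: the first literal of status `U` becomes the pivot `P`, the later `U`s candidates `C`
  (no `U` left: mode `fin`, the identity from then on);
* `cmp`, `|b_t| + 1` times: pass `s` checks bit `s` of *every* literal and compares, at each
  candidate's head, its bit `s` with the pivot's bit `s` (the pivot precedes all candidates):
  candidates failing become `N`; at the last pass (pivot exhausted) the survivors of equal
  length become `E`;
* `asg`: check marks cleared, units doubled, and one cell appended to every literal: `mark`
  for `P`/`E` (status `R`: these are exactly the literals on the variable `b_t`, which gets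
  rank `t`), `pre` for `N` (back to `U`), `post` for the already ranked `R`.

Main results: `renFST_eval_*` (one pass of each mode on encoded states), the ranking-step
lemma `renFST_iterate_step`, and `renFST_iterate_final`: from the initial state, after any
number `N ≥ rankPasses` of passes the state is `finalState`: units `2^v`, every literal on the
variable of rank `j` carrying the cells `pre^j mark post^(v-1-j)`, where the ranks are the
positions in the list `pivots` of the distinct occurring variables in order of first
occurrence (`pivots_nodup`, `mem_pivots_iff`); with the size bounds `rankPasses_le`,
`length_iterate_renFST_le`.

## References

* R. Impagliazzo, R. Paturi, *On the complexity of k-SAT*, JCSS 62 (2001) 367–375, §1,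
  doi:10.1006/jcss.2000.1727.
* J. E. Hopcroft, J. D. Ullman, *Introduction to Automata Theory, Languages, and Computation*,
  Addison-Wesley 1979, §2.7, §11.2 (Mealy machines, generalised sequential machines).
-/

namespace Literature.Computability.FineGrained.BruteForce

open Complexity

/-! ### Alphabet and transducer -/

/-- Modes of the renaming stage. [folklore] -/
inductive RMode | sel | cmp | asg | fin
  deriving DecidableEq, Fintype

/-- Kinds of cells appended at a ranking step: before the literal's own step, at it, after it.
[folklore] -/
inductive CellKind | pre | mark | post
  deriving DecidableEq, Fintype

/-- Statuses of a literal: unranked, pivot, candidate, equal to the pivot, not equal, ranked.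
[folklore] -/
inductive LSt | U | P | C | E | N | R
  deriving DecidableEq, Fintype

/-- Symbols of the renaming stage. [folklore] -/
inductive RSym
  | mode (m : RMode)
  | unit
  | bra
  | ket
  | ibit (chk b : Bool)
  | cell (k : CellKind)
  | head (st : LSt) (pol : Bool)
  deriving DecidableEq, Fintype

/-- default symbol [folklore] -/
instance : Inhabited RSym := ⟨RSym.unit⟩

-- the derived `Fintype` proxy (nested sigma types) exceeds the default instance size bound
set_option synthInstance.maxSize 1024 in
/-- States of the renaming transducer: before the mode symbol; in a `sel` pass (pivot found?);
in a `cmp` pass (pivot's bit once seen — `some none` = pivot exhausted —, whether the current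
literal's first unchecked bit was met, and that bit); in an `asg` pass; copying (`fin` pass).
[folklore] -/
inductive RSt
  | start
  | selS (found : Bool)
  | cmpS (c : Option (Option Bool)) (seen : Bool) (d : Option Bool)
  | asgS
  | finS
  deriving DecidableEq, Fintype

/-- Outcome of comparing a candidate's bit `d` with the pivot's bit `c` (`none` = no bit left).
[folklore] -/
def cmpRes (c d : Option Bool) : LSt :=
  match c, d with
  | none, none => .E
  | some x, some y => if x = y then .C else .N
  | _, _ => .N

/-- Status update at a head during a `cmp` pass. [folklore] -/
def cmpSt (c : Option (Option Bool)) (d : Option Bool) : LSt → LSt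
  | .C => match c with
    | some cv => cmpRes cv d
    | none => .C
  | st => st

/-- The cell appended and the new status at a head during an `asg` pass. [folklore] -/
def asgOut : LSt → CellKind × LSt
  | .P => (.mark, .R)
  | .E => (.mark, .R)
  | .R => (.post, .R)
  | _ => (.pre, .U)

/-- Transition function of the renaming transducer. [folklore] -/
def renStep : RSt → RSym → RSt × List RSym
  | .start, .mode .sel => (.selS false, [])
  | .start, .mode .cmp => (.cmpS none false none, [])
  | .start, .mode .asg => (.asgS, [])
  | .start, .mode .fin => (.finS, [])
  | .start, x => (.finS, [x])
  | .selS found, .head .U pol => (.selS true, [.head (if found then .C else .P) pol])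
  | .selS found, x => (.selS found, [x])
  | .cmpS c seen d, .ibit chk b =>
      if chk then (.cmpS c seen d, [.ibit true b])
      else if seen then (.cmpS c seen d, [.ibit false b])
      else (.cmpS c true (some b), [.ibit true b])
  | .cmpS c _ d, .head st pol =>
      ((if st = .P then .cmpS (some d) false none else .cmpS c false none), [.head (cmpSt c d st) pol])
  | .cmpS c seen d, x => (.cmpS c seen d, [x])
  | .asgS, .unit => (.asgS, [.unit, .unit])
  | .asgS, .ibit _ b => (.asgS, [.ibit false b])
  | .asgS, .head st pol => (.asgS, [.cell (asgOut st).1, .head (asgOut st).2 pol])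
  | .asgS, x => (.asgS, [x])
  | .finS, x => (.finS, [x])

/-- The new mode symbol, prepended at the end of the pass. [folklore] -/
def renFront : RSt → List RSym
  | .start => []
  | .selS found => [.mode (if found then .cmp else .fin)]
  | .cmpS c _ _ => [.mode (if c = some none then .asg else .cmp)]
  | .asgS => [.mode .sel]
  | .finS => [.mode .fin]

/-- **The renaming transducer.** [folklore] -/
def renFST : FST RSt RSym RSym where
  init := .start
  step := renStep
  front := renFront
  keep _ := true

/-- The transducer's step is `renStep`. [folklore] -/
theorem renFST_step (s : RSt) (x : RSym) : renFST.step s x = renStep s x := rfl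

/-- The transducer starts in `start`. [folklore] -/
theorem renFST_init : renFST.init = RSt.start := rfl

/-- Every transition emits at most two symbols. [folklore] -/
theorem renStep_length_le (s : RSt) (x : RSym) : (renStep s x).2.length ≤ 2 := by
  cases s <;> cases x <;> (try cases ‹RMode›) <;> (try cases ‹LSt›) <;> simp only [renStep] <;>
    (try split) <;> (try split) <;> simp

/-- `maxEmit renFST ≤ 2`. [folklore] -/
theorem renFST_maxEmit_le : renFST.maxEmit ≤ 2 :=
  Finset.sup_le fun p _ => renStep_length_le p.1 p.2

/-! ### Abstract states: literals, tokens, encodings -/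

/-- A literal of the renaming stage: index bits, number of checked bits, cells, status,
polarity. [folklore] -/
structure RLit where
  /-- the index of the variable (`Computability.encodeNat`, least significant bit first) -/
  bits : List Bool
  /-- number of checked bits (from the left; may exceed the length, meaning all checked) -/
  chk : ℕ
  /-- the cells appended so far -/
  cells : List CellKind
  /-- status -/
  st : LSt
  /-- polarity -/
  pol : Bool

/-- Tokens of the body: a bracket (`ket?`) or a literal. Passes of the renaming stage treat
brackets as inert, so the clause structure plays no role in this file. [folklore] -/
inductive Tok
  | br (isKet : Bool)
  | lit (l : RLit)

/-- Index bits with the first `k` checked. [folklore] -/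
def markBits : ℕ → List Bool → List RSym
  | _, [] => []
  | 0, b :: bs => .ibit false b :: markBits 0 bs
  | k + 1, b :: bs => .ibit true b :: markBits k bs

/-- `markBits` of no bit. [folklore] -/
@[simp] theorem markBits_nil (k : ℕ) : markBits k [] = [] := by cases k <;> rfl

/-- `markBits 0`: all bits unchecked. [folklore] -/
@[simp] theorem markBits_zero_cons (b : Bool) (bs : List Bool) :
    markBits 0 (b :: bs) = .ibit false b :: markBits 0 bs := rfl

/-- `markBits (k + 1)`: the first bit is checked. [folklore] -/
@[simp] theorem markBits_succ_cons (k : ℕ) (b : Bool) (bs : List Bool) :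
    markBits (k + 1) (b :: bs) = .ibit true b :: markBits k bs := rfl

/-- `markBits 0` is a map. [folklore] -/
theorem markBits_zero (bs : List Bool) : markBits 0 bs = bs.map (.ibit false) := by
  induction bs with
  | nil => rfl
  | cons b bs ih => simp [ih]

/-- One symbol per bit. [folklore] -/
@[simp] theorem length_markBits (k : ℕ) (bs : List Bool) : (markBits k bs).length = bs.length := by
  induction bs generalizing k with
  | nil => simp
  | cons b bs ih => cases k <;> simp [ih]

/-- Encoding of a literal: marked bits, cells, head. [folklore] -/
def encLit (l : RLit) : List RSym :=
  markBits l.chk l.bits ++ (l.cells.map RSym.cell ++ [.head l.st l.pol])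

/-- Encoding of a token. [folklore] -/
def encTok : Tok → List RSym
  | .br false => [.bra]
  | .br true => [.ket]
  | .lit l => encLit l

/-- Encoding of the body. [folklore] -/
def encBody (ts : List Tok) : List RSym := ts.flatMap encTok

/-- `encBody` of no token. [folklore] -/
@[simp] theorem encBody_nil : encBody [] = [] := rfl

/-- `encBody` token by token. [folklore] -/
theorem encBody_cons (t : Tok) (ts : List Tok) : encBody (t :: ts) = encTok t ++ encBody ts := rfl

/-- `encBody` is a monoid morphism. [folklore] -/
theorem encBody_append (ts ts' : List Tok) : encBody (ts ++ ts') = encBody ts ++ encBody ts' := by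
  simp [encBody]

/-- The state word: mode, units, body. [folklore] -/
def encState (m : RMode) (u : ℕ) (ts : List Tok) : List RSym :=
  .mode m :: (List.replicate u .unit ++ encBody ts)

/-! ### Abstract passes -/

/-- `sel` at a literal: the first `U` becomes `P`, later ones `C`. [folklore] -/
def selLit (found : Bool) (l : RLit) : Bool × RLit :=
  if l.st = .U then (true, { l with st := if found then .C else .P }) else (found, l)

/-- `sel` on a token. [folklore] -/
def selTok (found : Bool) : Tok → Bool × Tok
  | .br k => (found, .br k)
  | .lit l => ((selLit found l).1, .lit (selLit found l).2)

/-- `sel` on a bracket. [folklore] -/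
@[simp] theorem selTok_br (found k : Bool) : selTok found (.br k) = (found, .br k) := rfl

/-- `sel` on a literal token. [folklore] -/
@[simp] theorem selTok_lit (found : Bool) (l : RLit) :
    selTok found (.lit l) = ((selLit found l).1, .lit (selLit found l).2) := rfl

/-- `sel` on the body (threading "pivot found"). [folklore] -/
def selPass : Bool → List Tok → Bool × List Tok
  | found, [] => (found, [])
  | found, t :: ts => ((selPass (selTok found t).1 ts).1, (selTok found t).2 :: (selPass (selTok found t).1 ts).2)

/-- `sel` on the empty body. [folklore] -/
@[simp] theorem selPass_nil (found : Bool) : selPass found [] = (found, []) := rfl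

/-- `sel` token by token. [folklore] -/
@[simp] theorem selPass_cons (found : Bool) (t : Tok) (ts : List Tok) :
    selPass found (t :: ts) =
      ((selPass (selTok found t).1 ts).1, (selTok found t).2 :: (selPass (selTok found t).1 ts).2) := rfl

/-- `cmp` at a literal: check one more bit, read bit `chk`, update the status; the pivot
publishes its bit. [folklore] -/
def cmpLit (c : Option (Option Bool)) (l : RLit) : Option (Option Bool) × RLit :=
  ((if l.st = .P then some l.bits[l.chk]? else c),
    { l with chk := l.chk + 1, st := cmpSt c l.bits[l.chk]? l.st })

/-- `cmp` on a token. [folklore] -/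
def cmpTok (c : Option (Option Bool)) : Tok → Option (Option Bool) × Tok
  | .br k => (c, .br k)
  | .lit l => ((cmpLit c l).1, .lit (cmpLit c l).2)

/-- `cmp` on a bracket. [folklore] -/
@[simp] theorem cmpTok_br (c : Option (Option Bool)) (k : Bool) : cmpTok c (.br k) = (c, .br k) := rfl

/-- `cmp` on a literal token. [folklore] -/
@[simp] theorem cmpTok_lit (c : Option (Option Bool)) (l : RLit) :
    cmpTok c (.lit l) = ((cmpLit c l).1, .lit (cmpLit c l).2) := rfl

/-- `cmp` on the body (threading the pivot's bit). [folklore] -/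
def cmpPass : Option (Option Bool) → List Tok → Option (Option Bool) × List Tok
  | c, [] => (c, [])
  | c, t :: ts => ((cmpPass (cmpTok c t).1 ts).1, (cmpTok c t).2 :: (cmpPass (cmpTok c t).1 ts).2)

/-- `cmp` on the empty body. [folklore] -/
@[simp] theorem cmpPass_nil (c : Option (Option Bool)) : cmpPass c [] = (c, []) := rfl

/-- `cmp` token by token. [folklore] -/
@[simp] theorem cmpPass_cons (c : Option (Option Bool)) (t : Tok) (ts : List Tok) :
    cmpPass c (t :: ts) = ((cmpPass (cmpTok c t).1 ts).1, (cmpTok c t).2 :: (cmpPass (cmpTok c t).1 ts).2) := rfl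

/-- `asg` at a literal: clear the check marks, append the cell, update the status.
[folklore] -/
def asgLit (l : RLit) : RLit :=
  { l with chk := 0, cells := l.cells ++ [(asgOut l.st).1], st := (asgOut l.st).2 }

/-- `asg` on a token. [folklore] -/
def asgTok : Tok → Tok
  | .br k => .br k
  | .lit l => .lit (asgLit l)

/-- `asg` on a bracket. [folklore] -/
@[simp] theorem asgTok_br (k : Bool) : asgTok (.br k) = .br k := rfl

/-- `asg` on a literal token. [folklore] -/
@[simp] theorem asgTok_lit (l : RLit) : asgTok (.lit l) = .lit (asgLit l) := rfl

/-- `asg` on the body. [folklore] -/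
def asgPass (ts : List Tok) : List Tok := ts.map asgTok

/-! ### Run lemmas -/

section Run


/-- States that copy units, brackets and cells. [folklore] -/
def Copies (s : RSt) : Prop :=
  ∀ x : RSym, (x = .unit ∨ x = .bra ∨ x = .ket ∨ ∃ k, x = .cell k) → renStep s x = (s, [x])

/-- `selS` copies. [folklore] -/
theorem copies_selS (found : Bool) : Copies (.selS found) := by
  rintro x (rfl | rfl | rfl | ⟨k, rfl⟩) <;> rfl

/-- `cmpS` copies. [folklore] -/
theorem copies_cmpS (c : Option (Option Bool)) (seen : Bool) (d : Option Bool) :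
    Copies (.cmpS c seen d) := by
  rintro x (rfl | rfl | rfl | ⟨k, rfl⟩) <;> rfl

/-- `finS` copies. [folklore] -/
theorem copies_finS : Copies .finS := by
  rintro x (rfl | rfl | rfl | ⟨k, rfl⟩) <;> rfl

/-- A copying state copies a block of units. [folklore] -/
theorem run_units {s : RSt} (hs : Copies s) (u : ℕ) (rest : List RSym) :
    renFST.run s (List.replicate u .unit ++ rest) = ((renFST.run s rest).1, List.replicate u .unit ++ (renFST.run s rest).2) := by
  induction u with
  | zero => simp
  | succ u ih =>
    rw [List.replicate_succ, List.cons_append, FST.run_cons, renFST_step, hs _ (Or.inl rfl)]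
    simp [ih]

/-- A copying state copies cells. [folklore] -/
theorem run_cells {s : RSt} (hs : Copies s) (cs : List CellKind) (rest : List RSym) :
    renFST.run s (cs.map RSym.cell ++ rest) = ((renFST.run s rest).1, cs.map RSym.cell ++ (renFST.run s rest).2) := by
  induction cs with
  | nil => simp
  | cons k cs ih =>
    rw [List.map_cons, List.cons_append, FST.run_cons, renFST_step, hs _ (Or.inr (Or.inr (Or.inr ⟨k, rfl⟩)))]
    simp [ih]

/-- A copying state copies a bracket token. [folklore] -/
theorem run_br {s : RSt} (hs : Copies s) (k : Bool) (rest : List RSym) :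
    renFST.run s (encTok (.br k) ++ rest) = ((renFST.run s rest).1, encTok (.br k) ++ (renFST.run s rest).2) := by
  cases k
  · rw [show encTok (.br false) = [RSym.bra] from rfl, List.singleton_append, FST.run_cons,
      renFST_step, hs _ (Or.inr (Or.inl rfl))]
  · rw [show encTok (.br true) = [RSym.ket] from rfl, List.singleton_append, FST.run_cons,
      renFST_step, hs _ (Or.inr (Or.inr (Or.inl rfl)))]

/-! #### `fin` -/

/-- `finS` copies everything. [folklore] -/
theorem run_finS (w : List RSym) : renFST.run .finS w = (.finS, w) := by
  induction w with
  | nil => rfl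
  | cons x w ih => rw [FST.run_cons, renFST_step]; cases x <;> simp [renStep, ih]

/-! #### `sel` -/

/-- `selS` copies marked bits. [folklore] -/
theorem run_selS_markBits (found : Bool) (k : ℕ) (bs : List Bool) (rest : List RSym) :
    renFST.run (.selS found) (markBits k bs ++ rest) =
      ((renFST.run (.selS found) rest).1, markBits k bs ++ (renFST.run (.selS found) rest).2) := by
  induction bs generalizing k with
  | nil => simp
  | cons b bs ih =>
    cases k with
    | zero => rw [markBits_zero_cons, List.cons_append, FST.run_cons, renFST_step]; simp [renStep, ih]
    | succ k => rw [markBits_succ_cons, List.cons_append, FST.run_cons, renFST_step]; simp [renStep, ih]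

/-- `sel` on a literal. [folklore] -/
theorem run_selS_encLit (found : Bool) (l : RLit) (rest : List RSym) :
    renFST.run (.selS found) (encLit l ++ rest) =
      ((renFST.run (.selS (selLit found l).1) rest).1, encLit (selLit found l).2 ++ (renFST.run (.selS (selLit found l).1) rest).2) := by
  rw [encLit, List.append_assoc, run_selS_markBits, List.append_assoc, run_cells (copies_selS _),
    List.singleton_append, FST.run_cons, renFST_step]
  cases hst : l.st <;> simp [renStep, selLit, encLit, hst]

/-- `sel` on a token. [folklore] -/
theorem run_selS_encTok (found : Bool) (t : Tok) (rest : List RSym) :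
    renFST.run (.selS found) (encTok t ++ rest) =
      ((renFST.run (.selS (selTok found t).1) rest).1, encTok (selTok found t).2 ++ (renFST.run (.selS (selTok found t).1) rest).2) := by
  cases t with
  | br k => exact run_br (copies_selS _) k rest
  | lit l => exact run_selS_encLit found l rest

/-- `sel` on the body. [folklore] -/
theorem run_selS_encBody (found : Bool) (ts : List Tok) (rest : List RSym) :
    renFST.run (.selS found) (encBody ts ++ rest) =
      ((renFST.run (.selS (selPass found ts).1) rest).1,
        encBody (selPass found ts).2 ++ (renFST.run (.selS (selPass found ts).1) rest).2) := by
  induction ts generalizing found with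
  | nil => simp [selPass]
  | cons t ts ih => rw [encBody_cons, List.append_assoc, run_selS_encTok, ih]; simp [selPass, encBody_cons]

/-- **One `sel` pass.** [folklore] -/
theorem renFST_eval_sel (u : ℕ) (ts : List Tok) :
    renFST.eval (encState .sel u ts) =
      encState (if (selPass false ts).1 then .cmp else .fin) u (selPass false ts).2 := by
  rw [FST.eval, encState, FST.run_cons, renFST_init, renFST_step]
  simp only [renStep]
  have h := run_units (copies_selS false) u (encBody ts ++ [])
  rw [run_selS_encBody] at h
  simp only [List.append_nil, FST.run_nil] at h
  rw [h]
  simp [renFST, renFront, encState]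

/-! #### `cmp` -/

/-- `cmpS` after the first unchecked bit copies unchecked bits. [folklore] -/
theorem run_cmpS_seen_markBits_zero (c : Option (Option Bool)) (d : Option Bool) (bs : List Bool)
    (rest : List RSym) :
    renFST.run (.cmpS c true d) (markBits 0 bs ++ rest) =
      ((renFST.run (.cmpS c true d) rest).1, markBits 0 bs ++ (renFST.run (.cmpS c true d) rest).2) := by
  induction bs with
  | nil => simp
  | cons b bs ih => rw [markBits_zero_cons, List.cons_append, FST.run_cons, renFST_step]; simp [renStep, ih]

/-- `cmpS` on the marked bits of a literal: bit `k` is checked and read. [folklore] -/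
theorem run_cmpS_markBits (c : Option (Option Bool)) (k : ℕ) (bs : List Bool) (rest : List RSym) :
    renFST.run (.cmpS c false none) (markBits k bs ++ rest) =
      ((renFST.run (.cmpS c (decide (k < bs.length)) bs[k]?) rest).1,
        markBits (k + 1) bs ++ (renFST.run (.cmpS c (decide (k < bs.length)) bs[k]?) rest).2) := by
  induction bs generalizing k with
  | nil => simp
  | cons b bs ih =>
    cases k with
    | zero =>
      rw [markBits_zero_cons, List.cons_append, FST.run_cons, renFST_step]
      simp [renStep, run_cmpS_seen_markBits_zero]
    | succ k =>
      rw [markBits_succ_cons, List.cons_append, FST.run_cons, renFST_step]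
      simp [renStep, ih]

/-- `cmp` on a literal. [folklore] -/
theorem run_cmpS_encLit (c : Option (Option Bool)) (l : RLit) (rest : List RSym) :
    renFST.run (.cmpS c false none) (encLit l ++ rest) =
      ((renFST.run (.cmpS (cmpLit c l).1 false none) rest).1,
        encLit (cmpLit c l).2 ++ (renFST.run (.cmpS (cmpLit c l).1 false none) rest).2) := by
  rw [encLit, List.append_assoc, run_cmpS_markBits, List.append_assoc, run_cells (copies_cmpS _ _ _),
    List.singleton_append, FST.run_cons, renFST_step]
  by_cases hst : l.st = .P <;> simp [renStep, cmpLit, encLit, hst]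

/-- `cmp` on a token. [folklore] -/
theorem run_cmpS_encTok (c : Option (Option Bool)) (t : Tok) (rest : List RSym) :
    renFST.run (.cmpS c false none) (encTok t ++ rest) =
      ((renFST.run (.cmpS (cmpTok c t).1 false none) rest).1,
        encTok (cmpTok c t).2 ++ (renFST.run (.cmpS (cmpTok c t).1 false none) rest).2) := by
  cases t with
  | br k => exact run_br (copies_cmpS _ _ _) k rest
  | lit l => exact run_cmpS_encLit c l rest

/-- `cmp` on the body. [folklore] -/
theorem run_cmpS_encBody (c : Option (Option Bool)) (ts : List Tok) (rest : List RSym) :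
    renFST.run (.cmpS c false none) (encBody ts ++ rest) =
      ((renFST.run (.cmpS (cmpPass c ts).1 false none) rest).1,
        encBody (cmpPass c ts).2 ++ (renFST.run (.cmpS (cmpPass c ts).1 false none) rest).2) := by
  induction ts generalizing c with
  | nil => simp [cmpPass]
  | cons t ts ih => rw [encBody_cons, List.append_assoc, run_cmpS_encTok, ih]; simp [cmpPass, encBody_cons]

/-- **One `cmp` pass.** [folklore] -/
theorem renFST_eval_cmp (u : ℕ) (ts : List Tok) :
    renFST.eval (encState .cmp u ts) =
      encState (if (cmpPass none ts).1 = some none then .asg else .cmp) u (cmpPass none ts).2 := by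
  rw [FST.eval, encState, FST.run_cons, renFST_init, renFST_step]
  simp only [renStep]
  have h := run_units (copies_cmpS none false none) u (encBody ts ++ [])
  rw [run_cmpS_encBody] at h
  simp only [List.append_nil, FST.run_nil] at h
  rw [h]
  simp [renFST, renFront, encState]

/-! #### `asg` -/

/-- `asgS` doubles the units. [folklore] -/
theorem run_asgS_units (u : ℕ) (rest : List RSym) :
    renFST.run .asgS (List.replicate u .unit ++ rest) = ((renFST.run .asgS rest).1, List.replicate (2 * u) .unit ++ (renFST.run .asgS rest).2) := by
  induction u with
  | zero => simp
  | succ u ih =>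
    rw [List.replicate_succ, List.cons_append, FST.run_cons, renFST_step]
    simp only [renStep]
    rw [ih, show 2 * (u + 1) = 2 * u + 1 + 1 by ring, List.replicate_succ, List.replicate_succ]
    simp

/-- `asgS` clears the check marks. [folklore] -/
theorem run_asgS_markBits (k : ℕ) (bs : List Bool) (rest : List RSym) :
    renFST.run .asgS (markBits k bs ++ rest) = ((renFST.run .asgS rest).1, markBits 0 bs ++ (renFST.run .asgS rest).2) := by
  induction bs generalizing k with
  | nil => simp
  | cons b bs ih =>
    cases k with
    | zero => rw [markBits_zero_cons, List.cons_append, FST.run_cons, renFST_step]; simp [renStep, ih]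
    | succ k => rw [markBits_succ_cons, List.cons_append, FST.run_cons, renFST_step]; simp [renStep, ih]

/-- `asgS` copies cells. [folklore] -/
theorem run_asgS_cells (cs : List CellKind) (rest : List RSym) :
    renFST.run .asgS (cs.map RSym.cell ++ rest) = ((renFST.run .asgS rest).1, cs.map RSym.cell ++ (renFST.run .asgS rest).2) := by
  induction cs with
  | nil => simp
  | cons k cs ih => rw [List.map_cons, List.cons_append, FST.run_cons, renFST_step]; simp [renStep, ih]

/-- `asg` on a literal. [folklore] -/
theorem run_asgS_encLit (l : RLit) (rest : List RSym) :
    renFST.run .asgS (encLit l ++ rest) = ((renFST.run .asgS rest).1, encLit (asgLit l) ++ (renFST.run .asgS rest).2) := by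
  rw [encLit, List.append_assoc, run_asgS_markBits, List.append_assoc, run_asgS_cells,
    List.singleton_append, FST.run_cons, renFST_step]
  simp [renStep, asgLit, encLit]

/-- `asg` on a token. [folklore] -/
theorem run_asgS_encTok (t : Tok) (rest : List RSym) :
    renFST.run .asgS (encTok t ++ rest) = ((renFST.run .asgS rest).1, encTok (asgTok t) ++ (renFST.run .asgS rest).2) := by
  cases t with
  | br k =>
    cases k
    · rw [show encTok (.br false) = [RSym.bra] from rfl, List.singleton_append, FST.run_cons, renFST_step]; rfl
    · rw [show encTok (.br true) = [RSym.ket] from rfl, List.singleton_append, FST.run_cons, renFST_step]; rfl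
  | lit l => exact run_asgS_encLit l rest

/-- `asg` on the body. [folklore] -/
theorem run_asgS_encBody (ts : List Tok) (rest : List RSym) :
    renFST.run .asgS (encBody ts ++ rest) = ((renFST.run .asgS rest).1, encBody (asgPass ts) ++ (renFST.run .asgS rest).2) := by
  induction ts with
  | nil => simp [asgPass]
  | cons t ts ih => rw [encBody_cons, List.append_assoc, run_asgS_encTok, ih]; simp [asgPass, encBody_cons]

/-- **One `asg` pass.** [folklore] -/
theorem renFST_eval_asg (u : ℕ) (ts : List Tok) :
    renFST.eval (encState .asg u ts) = encState .sel (2 * u) (asgPass ts) := by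
  rw [FST.eval, encState, FST.run_cons, renFST_init, renFST_step]
  simp only [renStep]
  have h := run_asgS_units u (encBody ts ++ [])
  rw [run_asgS_encBody] at h
  simp only [List.append_nil, FST.run_nil] at h
  rw [h]
  simp [renFST, renFront, encState]

/-- **One `fin` pass**: the identity. [folklore] -/
theorem renFST_eval_fin (u : ℕ) (ts : List Tok) :
    renFST.eval (encState .fin u ts) = encState .fin u ts := by
  rw [FST.eval, encState, FST.run_cons, renFST_init, renFST_step]
  simp only [renStep]
  rw [run_finS]
  simp [renFST, renFront]

end Run

/-! ### The input formula as tokens; canonical states -/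

/-- Tokens of the input formula: brackets and literals `(index bits, polarity)`. [folklore] -/
inductive OTok
  | br (isKet : Bool)
  | lit (b : List Bool) (pol : Bool)

/-- The indices of the literals of a token list, in order. [folklore] -/
def litBits : List OTok → List (List Bool)
  | [] => []
  | .br _ :: ts => litBits ts
  | .lit b _ :: ts => b :: litBits ts

/-- `litBits` of no token. [folklore] -/
@[simp] theorem litBits_nil : litBits [] = [] := rfl

/-- `litBits` skips a bracket. [folklore] -/
@[simp] theorem litBits_cons_br (k : Bool) (ts : List OTok) : litBits (.br k :: ts) = litBits ts := rfl

/-- `litBits` records a literal. [folklore] -/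
@[simp] theorem litBits_cons_lit (b : List Bool) (pol : Bool) (ts : List OTok) :
    litBits (.lit b pol :: ts) = b :: litBits ts := rfl

/-- `litBits` is a monoid morphism. [folklore] -/
@[simp] theorem litBits_append (ts ts' : List OTok) : litBits (ts ++ ts') = litBits ts ++ litBits ts' := by
  induction ts with
  | nil => rfl
  | cons t ts ih => cases t <;> simp [ih]

/-- A literal's index is among `litBits`. [folklore] -/
theorem mem_litBits_of_mem {ts : List OTok} {b : List Bool} {pol : Bool} (h : OTok.lit b pol ∈ ts) :
    b ∈ litBits ts := by
  induction ts with
  | nil => simp at h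
  | cons t ts ih =>
    simp only [List.mem_cons] at h
    rcases h with rfl | h
    · simp
    · cases t <;> simp [ih h]

/-- Build the tokens of a state from the input tokens with a literal builder. [folklore] -/
def litTok (f : List Bool → Bool → RLit) : OTok → Tok
  | .br k => .br k
  | .lit b pol => .lit (f b pol)

/-- `litTok` on a bracket. [folklore] -/
@[simp] theorem litTok_br (f : List Bool → Bool → RLit) (k : Bool) : litTok f (.br k) = .br k := rfl

/-- `litTok` on a literal. [folklore] -/
@[simp] theorem litTok_lit (f : List Bool → Bool → RLit) (b : List Bool) (pol : Bool) :
    litTok f (.lit b pol) = .lit (f b pol) := rfl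

/-- Two builders agreeing on the literals present build the same tokens. [folklore] -/
theorem map_litTok_congr {f g : List Bool → Bool → RLit} {ots : List OTok}
    (h : ∀ b pol, OTok.lit b pol ∈ ots → f b pol = g b pol) : ots.map (litTok f) = ots.map (litTok g) := by
  apply List.map_congr_left
  intro t ht
  cases t with
  | br k => rfl
  | lit b pol => simp [h b pol ht]

/-- The cells of a literal on the variable `b` after the ranking steps with pivots `P`:
`pre^j mark post^(|P|-1-j)` if `b = P[j]`, else `pre^|P|`. [folklore] -/
def canonCells (P : List (List Bool)) (b : List Bool) : List CellKind :=
  if b ∈ P then List.replicate (P.idxOf b) .pre ++ .mark :: List.replicate (P.length - 1 - P.idxOf b) .post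
  else List.replicate P.length .pre

/-- One cell per ranking step. [folklore] -/
theorem length_canonCells (P : List (List Bool)) (b : List Bool) : (canonCells P b).length = P.length := by
  unfold canonCells
  split
  · rename_i h
    have := List.idxOf_lt_length_iff.2 h
    simp; omega
  · simp

/-- The literal on `(b, pol)` after the ranking steps with pivots `P` (between steps: no check
marks, status `R` if ranked else `U`). [folklore] -/
def canonLit (P : List (List Bool)) (b : List Bool) (pol : Bool) : RLit :=
  { bits := b, chk := 0, cells := canonCells P b, st := if b ∈ P then .R else .U, pol := pol }

/-- The body after the ranking steps with pivots `P`. [folklore] -/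
def canon (P : List (List Bool)) (ots : List OTok) : List Tok := ots.map (litTok (canonLit P))

/-- The next pivot: the index of the first literal not yet ranked. [folklore] -/
def nextPivot (P : List (List Bool)) (Lb : List (List Bool)) : Option (List Bool) :=
  Lb.find? fun b => decide (b ∉ P)

/-! ### Passes on built token lists -/

/-- `sel` does nothing where no literal is `U`. [folklore] -/
theorem selPass_map_of_ne (found : Bool) (f : List Bool → Bool → RLit) (ots : List OTok)
    (h : ∀ b pol, OTok.lit b pol ∈ ots → (f b pol).st ≠ .U) :
    selPass found (ots.map (litTok f)) = (found, ots.map (litTok f)) := by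
  induction ots with
  | nil => rfl
  | cons t ots ih =>
    have ih' := ih (fun b pol hm => h b pol (by simp [hm]))
    cases t with
    | br k => simp [ih']
    | lit b pol => simp [selLit, h b pol (by simp), ih']

/-- `sel` after the pivot: every `U` becomes `C`. [folklore] -/
theorem selPass_true_map (f : List Bool → Bool → RLit) (ots : List OTok) :
    selPass true (ots.map (litTok f)) = (true, ots.map (litTok fun b pol => (selLit true (f b pol)).2)) := by
  induction ots with
  | nil => rfl
  | cons t ots ih =>
    cases t with
    | br k => simp [ih]
    | lit b pol =>
      have h1 : (selLit true (f b pol)).1 = true := by unfold selLit; split <;> rfl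
      simp [h1, ih]

/-- `cmp` where no literal is the pivot: the pivot's bit is passed through. [folklore] -/
theorem cmpPass_map_of_ne (c : Option (Option Bool)) (f : List Bool → Bool → RLit) (ots : List OTok)
    (h : ∀ b pol, (f b pol).st ≠ .P) :
    cmpPass c (ots.map (litTok f)) = (c, ots.map (litTok fun b pol => (cmpLit c (f b pol)).2)) := by
  induction ots with
  | nil => rfl
  | cons t ots ih =>
    cases t with
    | br k => simp [ih]
    | lit b pol =>
      have h1 : (cmpLit c (f b pol)).1 = c := by simp [cmpLit, h b pol]
      simp [h1, ih]

/-- `asg` after a builder is a builder. [folklore] -/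
theorem asgTok_comp_litTok (f : List Bool → Bool → RLit) :
    asgTok ∘ litTok f = litTok fun b pol => asgLit (f b pol) := by
  funext t; cases t <;> rfl

/-- `asg` acts literal by literal. [folklore] -/
theorem asgPass_map (f : List Bool → Bool → RLit) (ots : List OTok) :
    asgPass (ots.map (litTok f)) = ots.map (litTok fun b pol => asgLit (f b pol)) := by
  induction ots with
  | nil => rfl
  | cons t ots ih => cases t <;> simp_all [asgPass]

/-- `sel` over a concatenation. [folklore] -/
theorem selPass_append (found : Bool) (ts ts' : List Tok) :
    selPass found (ts ++ ts') =
      ((selPass (selPass found ts).1 ts').1, (selPass found ts).2 ++ (selPass (selPass found ts).1 ts').2) := by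
  induction ts generalizing found with
  | nil => rfl
  | cons t ts ih => simp [ih]

/-- `cmp` over a concatenation. [folklore] -/
theorem cmpPass_append (c : Option (Option Bool)) (ts ts' : List Tok) :
    cmpPass c (ts ++ ts') =
      ((cmpPass (cmpPass c ts).1 ts').1, (cmpPass c ts).2 ++ (cmpPass (cmpPass c ts).1 ts').2) := by
  induction ts generalizing c with
  | nil => rfl
  | cons t ts ih => simp [ih]

/-! ### The comparison chain of a candidate -/

/-- Status of a candidate on the variable `b'` after `s` comparison passes against the pivot
`b` (pass `s` compares the bits numbered `s`). [folklore] -/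
def stAfter (b b' : List Bool) : ℕ → LSt
  | 0 => .C
  | s + 1 => cmpSt (some b[s]?) b'[s]? (stAfter b b' s)

/-- The remaining comparison, as a recursion on the pivot's remaining bits. [folklore] -/
def cmpRun : List Bool → List Bool → LSt → LSt
  | [], b', st => cmpSt (some none) b'[0]? st
  | x :: b, b', st => cmpRun b (b'.drop 1) (cmpSt (some (some x)) b'[0]? st)

/-- `cmpSt` only changes candidates. [folklore] -/
theorem cmpSt_of_ne_C (c : Option (Option Bool)) (d : Option Bool) {st : LSt} (h : st ≠ .C) :
    cmpSt c d st = st := by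
  cases st <;> simp_all [cmpSt]

/-- A non-candidate is unchanged by the remaining comparison. [folklore] -/
theorem cmpRun_of_ne_C (b b' : List Bool) {st : LSt} (h : st ≠ .C) : cmpRun b b' st = st := by
  induction b generalizing b' with
  | nil => simp [cmpRun, cmpSt_of_ne_C _ _ h]
  | cons x b ih => simp [cmpRun, cmpSt_of_ne_C _ _ h, ih]

/-- **The comparison is correct**: a candidate ends `E` iff its index equals the pivot's, else
`N`. [folklore] -/
theorem cmpRun_C (b b' : List Bool) : cmpRun b b' .C = if b' = b then .E else .N := by
  induction b generalizing b' with
  | nil => cases b' <;> simp [cmpRun, cmpSt, cmpRes]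
  | cons x b ih =>
    cases b' with
    | nil => simp [cmpRun, cmpSt, cmpRes, cmpRun_of_ne_C]
    | cons y b' =>
      by_cases hxy : x = y
      · subst hxy; simp [cmpRun, cmpSt, cmpRes, ih]
      · simp [cmpRun, cmpSt, cmpRes, hxy, cmpRun_of_ne_C, Ne.symm hxy]

/-- The passes realise the comparison: after `s ≤ |b|` passes the remaining comparison of the
current status is the full comparison. [folklore] -/
theorem cmpRun_drop_stAfter (b b' : List Bool) {s : ℕ} (hs : s ≤ b.length) :
    cmpRun (b.drop s) (b'.drop s) (stAfter b b' s) = cmpRun b b' .C := by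
  induction s with
  | zero => rfl
  | succ s ih =>
    rw [← ih (Nat.le_of_succ_le hs)]
    have hlt : s < b.length := hs
    rw [List.drop_eq_getElem_cons hlt, cmpRun, stAfter]
    simp [List.getElem?_eq_getElem hlt]

/-- **Status after all `|b| + 1` comparison passes.** [folklore] -/
theorem stAfter_length_succ (b b' : List Bool) :
    stAfter b b' (b.length + 1) = if b' = b then .E else .N := by
  rw [← cmpRun_C, ← cmpRun_drop_stAfter b b' le_rfl, stAfter, List.drop_length, cmpRun]
  simp

/-- A comparison outcome is never `P` nor `U`. [folklore] -/
theorem cmpRes_ne (cv d : Option Bool) : cmpRes cv d ≠ .P ∧ cmpRes cv d ≠ .U := by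
  unfold cmpRes
  split
  · simp
  · split <;> simp
  · simp

/-- `cmpSt` never produces `P` or `U` from another status. [folklore] -/
theorem cmpSt_ne (c : Option (Option Bool)) (d : Option Bool) {st : LSt} (hP : st ≠ .P) (hU : st ≠ .U) :
    cmpSt c d st ≠ .P ∧ cmpSt c d st ≠ .U := by
  cases st <;> simp_all only [cmpSt, ne_eq, not_false_eq_true, and_self, reduceCtorEq, not_true_eq_false]
  cases c with
  | none => simp
  | some cv => exact cmpRes_ne cv d

/-- A candidate's status is never `P` nor `U`. [folklore] -/
theorem stAfter_ne (b b' : List Bool) (s : ℕ) : stAfter b b' s ≠ .P ∧ stAfter b b' s ≠ .U := by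
  induction s with
  | zero => simp [stAfter]
  | succ s ih => rw [stAfter]; exact cmpSt_ne _ _ ih.1 ih.2

/-! ### Lengths -/

/-- Length of an encoded literal. [folklore] -/
@[simp] theorem length_encLit (l : RLit) : (encLit l).length = l.bits.length + l.cells.length + 1 := by
  simp [encLit, Nat.add_assoc]

/-- Bodies built by literal builders with equally long literals are equally long. [folklore] -/
theorem length_encBody_map_eq {f g : List Bool → Bool → RLit} (ots : List OTok)
    (h : ∀ b p, (encLit (f b p)).length = (encLit (g b p)).length) :
    (encBody (ots.map (litTok f))).length = (encBody (ots.map (litTok g))).length := by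
  induction ots with
  | nil => rfl
  | cons t ots ih =>
    cases t with
    | br k => cases k <;> simp [encBody_cons, encTok, ih]
    | lit b p => simp only [List.map_cons, litTok_lit, encBody_cons, encTok, List.length_append, h b p, ih]

/-- Bodies built by a literal builder with literals at most as long are at most as long.
[folklore] -/
theorem length_encBody_map_le {f g : List Bool → Bool → RLit} (ots : List OTok)
    (h : ∀ b p, (encLit (f b p)).length ≤ (encLit (g b p)).length) :
    (encBody (ots.map (litTok f))).length ≤ (encBody (ots.map (litTok g))).length := by
  induction ots with
  | nil => exact le_rfl
  | cons t ots ih =>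
    cases t with
    | br k => cases k <;> simpa [encBody_cons, encTok] using ih
    | lit b p =>
      simp only [List.map_cons, litTok_lit, encBody_cons, encTok, List.length_append]
      exact Nat.add_le_add (h b p) ih

/-! ### One ranking step -/

section Step

variable (P : List (List Bool)) (ots₁ : List OTok) (b : List Bool) (pol : Bool) (ots₂ : List OTok)

/-- The body during the comparison passes of a ranking step: ranked literals before the pivot,
the pivot, the rest (ranked, or candidates in their current status), all with `s` checked
bits. [folklore] -/
def stepBody (s : ℕ) : List Tok :=
  ots₁.map (litTok fun b' p' => { canonLit P b' p' with chk := s }) ++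
    .lit { canonLit P b pol with chk := s, st := .P } ::
      ots₂.map (litTok fun b' p' =>
        { canonLit P b' p' with chk := s, st := if b' ∈ P then .R else stAfter b b' s })

variable {P ots₁ b} (h₁ : ∀ b' ∈ litBits ots₁, b' ∈ P) (hb : b ∉ P)
include h₁ hb

/-- The `sel` pass of a ranking step. [folklore] -/
theorem selPass_canon_split :
    selPass false (canon P (ots₁ ++ .lit b pol :: ots₂)) = (true, stepBody P ots₁ b pol ots₂ 0) := by
  have hA : selPass false (ots₁.map (litTok (canonLit P))) = (false, ots₁.map (litTok (canonLit P))) :=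
    selPass_map_of_ne _ _ _ fun b' p' hm => by
      simp [canonLit, h₁ b' (mem_litBits_of_mem hm)]
  have e₀ : selLit false (canonLit P b pol) = (true, { canonLit P b pol with chk := 0, st := .P }) := by
    simp [selLit, canonLit, hb]
  have e₁ : ots₁.map (litTok (canonLit P)) = ots₁.map (litTok fun b' p' => { canonLit P b' p' with chk := 0 }) :=
    map_litTok_congr fun b' p' _ => by simp [canonLit]
  have e₂ : ots₂.map (litTok fun b' p' => (selLit true (canonLit P b' p')).2) =
      ots₂.map (litTok fun b' p' =>
        { canonLit P b' p' with chk := 0, st := if b' ∈ P then .R else stAfter b b' 0 }) :=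
    map_litTok_congr fun b' p' _ => by by_cases hb' : b' ∈ P <;> simp [selLit, canonLit, hb', stAfter]
  rw [canon, List.map_append, List.map_cons, selPass_append, hA]
  dsimp only
  rw [selPass_cons, litTok_lit, selTok_lit, e₀]
  dsimp only
  rw [selPass_true_map, e₂, e₁]
  rfl

omit h₁ hb in
/-- One `cmp` pass of a ranking step. [folklore] -/
theorem cmpPass_stepBody (s : ℕ) :
    cmpPass none (stepBody P ots₁ b pol ots₂ s) = (some b[s]?, stepBody P ots₁ b pol ots₂ (s + 1)) := by
  have hA : cmpPass none (ots₁.map (litTok fun b' p' => { canonLit P b' p' with chk := s })) =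
      (none, ots₁.map (litTok fun b' p' => { canonLit P b' p' with chk := s + 1 })) := by
    rw [cmpPass_map_of_ne _ _ _ (fun b' p' => by by_cases hb' : b' ∈ P <;> simp [canonLit, hb'])]
    simp only [Prod.mk.injEq, true_and]
    exact map_litTok_congr fun b' p' _ => by by_cases hb' : b' ∈ P <;> simp [cmpLit, canonLit, hb', cmpSt]
  have e₀ : cmpLit none { canonLit P b pol with chk := s, st := .P } =
      (some b[s]?, { canonLit P b pol with chk := s + 1, st := .P }) := by
    simp [cmpLit, canonLit, cmpSt]
  have hB : cmpPass (some b[s]?) (ots₂.map (litTok fun b' p' =>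
        { canonLit P b' p' with chk := s, st := if b' ∈ P then .R else stAfter b b' s })) =
      (some b[s]?, ots₂.map (litTok fun b' p' =>
        { canonLit P b' p' with chk := s + 1, st := if b' ∈ P then .R else stAfter b b' (s + 1) })) := by
    rw [cmpPass_map_of_ne _ _ _ (fun b' p' => by
      by_cases hb' : b' ∈ P <;> simp [hb', (stAfter_ne b b' s).1])]
    simp only [Prod.mk.injEq, true_and]
    exact map_litTok_congr fun b' p' _ => by by_cases hb' : b' ∈ P <;> simp [cmpLit, canonLit, hb', cmpSt, stAfter]
  rw [stepBody, cmpPass_append, hA]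
  dsimp only
  rw [cmpPass_cons, cmpTok_lit, e₀]
  dsimp only
  rw [hB]
  rfl

omit h₁ hb in
/-- The comparison passes of a ranking step: `s ≤ |b|` passes stay in mode `cmp`. [folklore] -/
theorem iterate_cmp_stepBody (u : ℕ) {s : ℕ} (hs : s ≤ b.length) :
    renFST.eval^[s] (encState .cmp u (stepBody P ots₁ b pol ots₂ 0)) =
      encState .cmp u (stepBody P ots₁ b pol ots₂ s) := by
  induction s with
  | zero => rfl
  | succ s ih =>
    rw [Function.iterate_succ_apply', ih (Nat.le_of_succ_le hs), renFST_eval_cmp, cmpPass_stepBody]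
    have : b[s]? ≠ none := by
      rw [Ne, List.getElem?_eq_none_iff]; omega
    simp [this]

/-- The `asg` pass of a ranking step yields the next canonical body. [folklore] -/
theorem asgPass_stepBody :
    asgPass (stepBody P ots₁ b pol ots₂ (b.length + 1)) = canon (P ++ [b]) (ots₁ ++ .lit b pol :: ots₂) := by
  have hidx : (P ++ [b]).idxOf b = P.length := by
    rw [List.idxOf_append_of_notMem hb]; simp
  -- the three kinds of literals: ranked, on the pivot's variable, other unranked
  have hR : ∀ b' p', b' ∈ P →
      asgLit { bits := b', chk := b.length + 1, cells := canonCells P b', st := .R, pol := p' } =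
        canonLit (P ++ [b]) b' p' := by
    intro b' p' hb'
    have hi : P.idxOf b' < P.length := List.idxOf_lt_length_iff.2 hb'
    simp only [asgLit, asgOut, canonCells, hb', ↓reduceIte, List.append_assoc, List.cons_append, canonLit,
      List.mem_append, true_or, List.idxOf_append_of_mem hb', List.length_append, List.length_singleton,
      RLit.mk.injEq, and_true, true_and]
    rw [show P.length + 1 - 1 - P.idxOf b' = P.length - 1 - P.idxOf b' + 1 by omega,
      List.replicate_succ']
  have hPiv : ∀ st p', (st = LSt.P ∨ st = LSt.E) →
      asgLit { bits := b, chk := b.length + 1, cells := canonCells P b, st := st, pol := p' } =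
        canonLit (P ++ [b]) b p' := by
    rintro st p' (rfl | rfl) <;> simp [asgLit, canonLit, hb, asgOut, canonCells, hidx]
  have hN : ∀ b' p', b' ∉ P → b' ≠ b →
      asgLit { bits := b', chk := b.length + 1, cells := canonCells P b', st := .N, pol := p' } =
        canonLit (P ++ [b]) b' p' := by
    intro b' p' hb' hne
    simp [asgLit, canonLit, hb', hne, asgOut, canonCells, List.replicate_succ']
  rw [stepBody, asgPass, List.map_append, List.map_cons, canon, List.map_append, List.map_cons,
    List.map_map, List.map_map, asgTok_comp_litTok, asgTok_comp_litTok]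
  congr 1
  · refine map_litTok_congr fun b' p' hm => ?_
    have hb' : b' ∈ P := h₁ b' (mem_litBits_of_mem hm)
    simp only [canonLit, hb', ↓reduceIte]
    exact hR b' p' hb'
  · congr 1
    · simp only [asgTok_lit, canonLit, hb, ↓reduceIte]
      rw [hPiv _ _ (Or.inl rfl)]
      simp [canonLit]
    · refine map_litTok_congr fun b' p' _ => ?_
      by_cases hb' : b' ∈ P
      · simp only [canonLit, hb', ↓reduceIte]
        exact hR b' p' hb'
      · simp only [canonLit, hb', ↓reduceIte, stAfter_length_succ]
        by_cases hbb : b' = b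
        · subst hbb
          simp only [↓reduceIte]
          rw [hPiv _ _ (Or.inr rfl)]
          simp [canonLit]
        · simp only [hbb, ↓reduceIte]
          exact hN b' p' hb' hbb

/-- **One ranking step**: `|b| + 3` passes from the canonical state with pivots `P` give the
canonical state with pivots `P ++ [b]`, units doubled, where `b ∉ P` is the index of a literal
preceded by ranked literals only. [folklore] -/
theorem renFST_iterate_step (u : ℕ) :
    renFST.eval^[b.length + 3] (encState .sel u (canon P (ots₁ ++ .lit b pol :: ots₂))) =
      encState .sel (2 * u) (canon (P ++ [b]) (ots₁ ++ .lit b pol :: ots₂)) := by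
  rw [show b.length + 3 = (b.length + 1 + 1) + 1 by ring, Function.iterate_succ_apply,
    renFST_eval_sel, selPass_canon_split pol ots₂ h₁ hb]
  simp only [↓reduceIte]
  rw [Function.iterate_succ_apply', Function.iterate_succ_apply', iterate_cmp_stepBody _ _ _ le_rfl,
    renFST_eval_cmp, cmpPass_stepBody]
  simp only [List.getElem?_length, ↓reduceIte]
  rw [renFST_eval_asg, asgPass_stepBody pol ots₂ h₁ hb]

/-- During a ranking step the state never gets longer than the next canonical state. [folklore] -/
theorem length_iterate_step_le (u : ℕ) {i : ℕ} (hi : i ≤ b.length + 3) :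
    (renFST.eval^[i] (encState .sel u (canon P (ots₁ ++ .lit b pol :: ots₂)))).length ≤
      (encState .sel (2 * u) (canon (P ++ [b]) (ots₁ ++ .lit b pol :: ots₂))).length := by
  -- lengths of the bodies met
  have hlen : ∀ s, (encBody (stepBody P ots₁ b pol ots₂ s)).length =
      (encBody (canon P (ots₁ ++ .lit b pol :: ots₂))).length := by
    intro s
    rw [stepBody, canon, List.map_append, List.map_cons, encBody_append, encBody_cons, encBody_append,
      encBody_cons, List.length_append, List.length_append, List.length_append, List.length_append,
      length_encBody_map_eq ots₁ (g := canonLit P) (fun b' p' => by simp [canonLit]),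
      length_encBody_map_eq ots₂ (g := canonLit P) (fun b' p' => by simp [canonLit])]
    simp [encTok, canonLit]
  have hmono : (encState .sel u (canon P (ots₁ ++ .lit b pol :: ots₂))).length ≤
      (encState .sel (2 * u) (canon (P ++ [b]) (ots₁ ++ .lit b pol :: ots₂))).length := by
    have := length_encBody_map_le (ots₁ ++ .lit b pol :: ots₂) (f := canonLit P) (g := canonLit (P ++ [b]))
      (fun b' p' => by simp [canonLit, length_canonCells])
    simp only [encState, List.length_cons, List.length_append, List.length_replicate, canon] at this ⊢
    omega
  rcases Nat.lt_or_ge i 1 with h0 | h0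
  · have : i = 0 := by omega
    subst this
    exact hmono
  rcases Nat.lt_or_ge i (b.length + 3) with h3 | h3
  · -- inside the step: `sel` then `i - 1 ≤ |b| + 1` comparison passes
    obtain ⟨j, rfl⟩ : ∃ j, i = j + 1 := ⟨i - 1, by omega⟩
    rw [Function.iterate_succ_apply, renFST_eval_sel, selPass_canon_split pol ots₂ h₁ hb]
    simp only [↓reduceIte]
    rcases Nat.lt_or_ge j (b.length + 1) with hj | hj
    · rw [iterate_cmp_stepBody _ _ _ (by omega)]
      refine le_trans ?_ hmono
      simp [encState, hlen]
    · have hj' : j = b.length + 1 := by omega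
      subst hj'
      rw [Function.iterate_succ_apply', iterate_cmp_stepBody _ _ _ le_rfl, renFST_eval_cmp,
        cmpPass_stepBody]
      refine le_trans ?_ hmono
      simp [encState, hlen]
  · have : i = b.length + 3 := by omega
    subst this
    rw [renFST_iterate_step pol ots₂ h₁ hb]

end Step

/-! ### The whole renaming stage -/

/-- Splitting the tokens at the next pivot. [folklore] -/
theorem exists_split_of_nextPivot {P : List (List Bool)} {ots : List OTok} {b : List Bool}
    (h : nextPivot P (litBits ots) = some b) :
    ∃ ots₁ pol ots₂, ots = ots₁ ++ .lit b pol :: ots₂ ∧ (∀ b' ∈ litBits ots₁, b' ∈ P) ∧ b ∉ P := by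
  induction ots with
  | nil => simp [nextPivot] at h
  | cons t ots ih =>
    cases t with
    | br k =>
      obtain ⟨ots₁, pol, ots₂, rfl, h₁, hb⟩ := ih (by simpa [nextPivot] using h)
      exact ⟨.br k :: ots₁, pol, ots₂, rfl, by simpa using h₁, hb⟩
    | lit b' p' =>
      by_cases hb' : b' ∈ P
      · obtain ⟨ots₁, pol, ots₂, rfl, h₁, hb⟩ := ih (by simpa [nextPivot, hb'] using h)
        refine ⟨.lit b' p' :: ots₁, pol, ots₂, rfl, ?_, hb⟩
        simpa [hb'] using h₁
      · have : b' = b := by simpa [nextPivot, hb'] using h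
        subst this
        exact ⟨[], p', ots, rfl, by simp, hb'⟩

/-- No next pivot: every literal is ranked. [folklore] -/
theorem forall_mem_of_nextPivot_eq_none {P : List (List Bool)} {Lb : List (List Bool)}
    (h : nextPivot P Lb = none) : ∀ b ∈ Lb, b ∈ P := by
  simpa [nextPivot] using h

/-- The pivots, by iterating "next pivot" with fuel `n` from the already chosen `P`. [folklore] -/
def pivotsAux (Lb : List (List Bool)) : ℕ → List (List Bool) → List (List Bool)
  | 0, P => P
  | n + 1, P =>
    match nextPivot P Lb with
    | none => P
    | some b => pivotsAux Lb n (P ++ [b])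

/-- **The pivots**: the distinct indices occurring in `Lb`, in order of first occurrence
(`pivots_nodup`, `mem_pivots_iff`); the rank of a variable is its position in this list.
Extensionally this is core's first-occurrence deduplication `List.eraseDups`; it is defined here
by the fuelled iteration of `nextPivot` because that is the recursion the passes follow (the
simulation `renFST_iterate_pivotsAux` is an induction on it). [folklore] -/
def pivots (Lb : List (List Bool)) : List (List Bool) := pivotsAux Lb Lb.length []

/-- The number of passes of the remaining ranking steps, with fuel `n`, plus the final `sel`
pass. [folklore] -/
def rankPassesAux (Lb : List (List Bool)) : ℕ → List (List Bool) → ℕ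
  | 0, _ => 1
  | n + 1, P =>
    match nextPivot P Lb with
    | none => 1
    | some b => b.length + 3 + rankPassesAux Lb n (P ++ [b])

/-- **The number of passes of the renaming stage**: `Σ (|b| + 3)` over the pivots `b`, plus one.
[folklore] -/
def rankPasses (Lb : List (List Bool)) : ℕ := rankPassesAux Lb Lb.length []

/-- The fuel measure: the number of distinct indices not yet ranked. [folklore] -/
def rem (Lb : List (List Bool)) (P : List (List Bool)) : ℕ :=
  (Lb.toFinset.filter fun b => b ∉ P).card

/-- Choosing a pivot decreases the measure. [folklore] -/
theorem rem_lt_of_nextPivot {Lb P : List (List Bool)} {b : List Bool} (h : nextPivot P Lb = some b) :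
    rem Lb (P ++ [b]) < rem Lb P := by
  have hbL : b ∈ Lb := List.mem_of_find?_eq_some h
  have hbP : b ∉ P := by simpa using List.find?_some h
  have e : (Lb.toFinset.filter fun x => x ∉ P ++ [b]) = (Lb.toFinset.filter fun x => x ∉ P).erase b := by
    ext x
    simp only [List.mem_append, List.mem_singleton, not_or, Finset.mem_filter, List.mem_toFinset,
      Finset.mem_erase]
    tauto
  rw [rem, rem, e]
  exact Finset.card_erase_lt_of_mem (by simp [hbL, hbP])

/-- Measure zero: no pivot left. [folklore] -/
theorem nextPivot_eq_none_of_rem {Lb P : List (List Bool)} (h : rem Lb P = 0) : nextPivot P Lb = none := by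
  rw [rem, Finset.card_eq_zero, Finset.filter_eq_empty_iff] at h
  rw [nextPivot, List.find?_eq_none]
  intro b hb
  simpa using h (by simpa using hb)

/-- **Specification of `pivotsAux`** (enough fuel): it extends `P`, ends with no pivot left,
stays duplicate-free, and only adds indices of `Lb`. [folklore] -/
theorem pivotsAux_spec (Lb : List (List Bool)) :
    ∀ (n : ℕ) (P : List (List Bool)), rem Lb P ≤ n →
      nextPivot (pivotsAux Lb n P) Lb = none ∧ P <+: pivotsAux Lb n P ∧
        (P.Nodup → (pivotsAux Lb n P).Nodup) ∧ ∀ b ∈ pivotsAux Lb n P, b ∈ P ∨ b ∈ Lb := by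
  intro n
  induction n with
  | zero =>
    intro P hP
    exact ⟨nextPivot_eq_none_of_rem (Nat.le_zero.mp hP), List.prefix_rfl, id, fun b hb => Or.inl hb⟩
  | succ n ih =>
    intro P hP
    rw [pivotsAux]
    cases h : nextPivot P Lb with
    | none => exact ⟨h, List.prefix_rfl, id, fun b hb => Or.inl hb⟩
    | some b =>
      have hlt := rem_lt_of_nextPivot h
      obtain ⟨h1, h2, h3, h4⟩ := ih (P ++ [b]) (by omega)
      have hbP : b ∉ P := by simpa using List.find?_some h
      refine ⟨h1, (List.prefix_append P [b]).trans h2, fun hnd => h3 ?_, fun b' hb' => ?_⟩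
      · rw [List.nodup_append]
        exact ⟨hnd, List.nodup_singleton b, fun a ha b' hb' => by
          rw [List.mem_singleton] at hb'; subst hb'; rintro rfl; exact hbP ha⟩
      · rcases h4 b' hb' with h' | h'
        · simp only [List.mem_append, List.mem_singleton] at h'
          rcases h' with h' | rfl
          · exact Or.inl h'
          · exact Or.inr (List.mem_of_find?_eq_some h)
        · exact Or.inr h'

/-- The fuel `|Lb|` suffices from `P = []`. [folklore] -/
theorem rem_nil_le (Lb : List (List Bool)) : rem Lb [] ≤ Lb.length := by
  rw [rem]
  exact (Finset.card_filter_le _ _).trans (List.toFinset_card_le _)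

/-- The pivots are duplicate-free. [folklore] -/
theorem pivots_nodup (Lb : List (List Bool)) : (pivots Lb).Nodup :=
  (pivotsAux_spec Lb _ _ (rem_nil_le Lb)).2.2.1 List.nodup_nil

/-- The pivots are exactly the occurring indices. [folklore] -/
theorem mem_pivots_iff (Lb : List (List Bool)) (b : List Bool) : b ∈ pivots Lb ↔ b ∈ Lb := by
  obtain ⟨h1, -, -, h4⟩ := pivotsAux_spec Lb _ _ (rem_nil_le Lb)
  constructor
  · intro hb
    rcases h4 b hb with h | h
    · simp at h
    · exact h
  · intro hb
    exact forall_mem_of_nextPivot_eq_none h1 b hb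

/-- Hence there are as many pivots as distinct occurring indices. [folklore] -/
theorem length_pivots (Lb : List (List Bool)) : (pivots Lb).length = Lb.toFinset.card := by
  rw [← List.toFinset_card_of_nodup (pivots_nodup Lb)]
  congr 1
  ext b
  simp [mem_pivots_iff]

/-- `rankPassesAux` sums `|b| + 3` over the pivots added. [folklore] -/
theorem rankPassesAux_eq (Lb : List (List Bool)) :
    ∀ (n : ℕ) (P : List (List Bool)), rem Lb P ≤ n →
      rankPassesAux Lb n P = (((pivotsAux Lb n P).drop P.length).map fun b => b.length + 3).sum + 1 := by
  intro n
  induction n with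
  | zero => intro P _; simp [rankPassesAux, pivotsAux]
  | succ n ih =>
    intro P hP
    rw [rankPassesAux, pivotsAux]
    cases h : nextPivot P Lb with
    | none => simp
    | some b =>
      have hlt := rem_lt_of_nextPivot h
      simp only
      rw [ih (P ++ [b]) (by omega)]
      obtain ⟨-, h2, -, -⟩ := pivotsAux_spec Lb n (P ++ [b]) (by omega)
      obtain ⟨rest, hrest⟩ := h2
      rw [← hrest]
      simp [Nat.add_assoc]

/-- **The renaming stage needs at most `Σ_literals (|index| + 3) + 1` passes.** [folklore] -/
theorem rankPasses_le (Lb : List (List Bool)) : rankPasses Lb ≤ (Lb.map fun b => b.length + 3).sum + 1 := by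
  rw [rankPasses, rankPassesAux_eq Lb _ _ (rem_nil_le Lb)]
  simp only [List.length_nil, List.drop_zero, add_le_add_iff_right]
  have hsub : List.Subperm (pivots Lb) Lb :=
    (pivots_nodup Lb).subperm fun b hb => (mem_pivots_iff Lb b).1 hb
  obtain ⟨l, hl, hls⟩ := hsub
  rw [pivots] at hl
  rw [← (hl.map _).sum_eq]
  exact (hls.map _).sum_le_sum fun _ _ => Nat.zero_le _

/-! ### The main iteration -/

section Main

variable (ots : List OTok)

/-- **The ranking steps, iterated** (enough fuel): from the canonical state with pivots `P`,
after any `N ≥ rankPassesAux` passes the state is final: mode `fin`, units multiplied by `2`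
for each new pivot, body canonical for all the pivots. [folklore] -/
theorem renFST_iterate_pivotsAux :
    ∀ (n : ℕ) (P : List (List Bool)) (u : ℕ), rem (litBits ots) P ≤ n →
      ∀ N, rankPassesAux (litBits ots) n P ≤ N →
        renFST.eval^[N] (encState .sel u (canon P ots)) =
          encState .fin (u * 2 ^ ((pivotsAux (litBits ots) n P).length - P.length))
            (canon (pivotsAux (litBits ots) n P) ots) := by
  -- the last step: no pivot left
  have hlast : ∀ P u, nextPivot P (litBits ots) = none → ∀ N, 1 ≤ N →
      renFST.eval^[N] (encState .sel u (canon P ots)) = encState .fin u (canon P ots) := by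
    intro P u h N hN
    obtain ⟨N, rfl⟩ := Nat.exists_eq_add_of_le' hN
    rw [Function.iterate_succ_apply, renFST_eval_sel, canon,
      selPass_map_of_ne _ _ _ (fun b p hm => by
        simp [canonLit, forall_mem_of_nextPivot_eq_none h b (mem_litBits_of_mem hm)])]
    simp only [Bool.false_eq_true, ↓reduceIte]
    clear hN
    induction N with
    | zero => rfl
    | succ N ih => rw [Function.iterate_succ_apply, renFST_eval_fin]; exact ih
  intro n
  induction n with
  | zero =>
    intro P u hP N hN
    rw [rankPassesAux] at hN
    simpa [pivotsAux] using hlast P u (nextPivot_eq_none_of_rem (Nat.le_zero.mp hP)) N hN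
  | succ n ih =>
    intro P u hP N hN
    rw [rankPassesAux] at hN
    rw [pivotsAux]
    cases h : nextPivot P (litBits ots) with
    | none =>
      rw [h] at hN
      simpa using hlast P u h N hN
    | some b =>
      rw [h] at hN
      simp only at hN
      have hlt := rem_lt_of_nextPivot h
      obtain ⟨ots₁, pol, ots₂, hots, h₁, hb⟩ := exists_split_of_nextPivot h
      obtain ⟨N, rfl⟩ := Nat.exists_eq_add_of_le' (le_of_add_le_left hN)
      rw [Function.iterate_add_apply, hots, renFST_iterate_step pol ots₂ h₁ hb, ← hots,
        ih (P ++ [b]) (2 * u) (by omega) N (by omega)]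
      obtain ⟨-, h2, -, -⟩ := pivotsAux_spec (litBits ots) n (P ++ [b]) (by omega)
      have hlen := h2.length_le
      simp only [List.length_append, List.length_singleton] at hlen
      set L' := (pivotsAux (litBits ots) n (P ++ [b])).length with hL'
      congr 1
      simp only [List.length_append, List.length_singleton]
      rw [show L' - P.length = L' - (P.length + 1) + 1 by omega, pow_succ]
      ring

/-- **Lengths along the iteration** (enough fuel): no intermediate state is longer than the
final one. [folklore] -/
theorem length_iterate_pivotsAux_le :
    ∀ (n : ℕ) (P : List (List Bool)) (u : ℕ), rem (litBits ots) P ≤ n → ∀ i,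
      (renFST.eval^[i] (encState .sel u (canon P ots))).length ≤
        (encState .fin (u * 2 ^ ((pivotsAux (litBits ots) n P).length - P.length))
          (canon (pivotsAux (litBits ots) n P) ots)).length := by
  intro n P u hP i
  rcases Nat.lt_or_ge i (rankPassesAux (litBits ots) n P) with hi | hi
  swap
  · rw [renFST_iterate_pivotsAux ots n P u hP i hi]
  induction n generalizing P u i with
  | zero =>
    rw [rankPassesAux] at hi
    have : i = 0 := by omega
    subst this
    simp [encState, pivotsAux]
  | succ n ih =>
    rw [rankPassesAux] at hi
    rw [pivotsAux]
    cases h : nextPivot P (litBits ots) with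
    | none =>
      rw [h] at hi
      have : i = 0 := by simpa using hi
      subst this
      simp [encState]
    | some b =>
      rw [h] at hi
      simp only at hi
      have hlt := rem_lt_of_nextPivot h
      obtain ⟨ots₁, pol, ots₂, hots, h₁, hb⟩ := exists_split_of_nextPivot h
      have key : ∀ j, (renFST.eval^[j] (encState .sel (2 * u) (canon (P ++ [b]) ots))).length ≤
          (encState .fin (u * 2 ^ ((pivotsAux (litBits ots) n (P ++ [b])).length - P.length))
            (canon (pivotsAux (litBits ots) n (P ++ [b])) ots)).length := by
        intro j
        obtain ⟨-, h2, -, -⟩ := pivotsAux_spec (litBits ots) n (P ++ [b]) (by omega)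
        have hlen := h2.length_le
        simp only [List.length_append, List.length_singleton] at hlen
        have e : u * 2 ^ ((pivotsAux (litBits ots) n (P ++ [b])).length - P.length) =
            2 * u * 2 ^ ((pivotsAux (litBits ots) n (P ++ [b])).length - (P ++ [b]).length) := by
          rw [show (pivotsAux (litBits ots) n (P ++ [b])).length - P.length =
            (pivotsAux (litBits ots) n (P ++ [b])).length - (P ++ [b]).length + 1 by simp; omega, pow_succ]
          ring
        rw [e]
        rcases Nat.lt_or_ge j (rankPassesAux (litBits ots) n (P ++ [b])) with hj | hj
        · exact ih (P ++ [b]) (2 * u) (by omega) j hj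
        · rw [renFST_iterate_pivotsAux ots n (P ++ [b]) (2 * u) (by omega) j hj]
      rcases Nat.lt_or_ge i (b.length + 3) with hi3 | hi3
      · refine le_trans ?_ (key 0)
        rw [Function.iterate_zero_apply, hots]
        exact length_iterate_step_le pol ots₂ h₁ hb u hi3.le
      · obtain ⟨j, rfl⟩ := Nat.exists_eq_add_of_le' hi3
        rw [Function.iterate_add_apply, hots, renFST_iterate_step pol ots₂ h₁ hb, ← hots]
        exact key j

/-- The initial body: all literals unranked, no cells, no check marks. [folklore] -/
def initBody : List Tok := canon [] ots

/-- **The final state of the renaming stage**: mode `fin`, `2^v` units, and the body canonical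
for the pivots (`v` = number of distinct occurring variables). [folklore] -/
def finalState : List RSym :=
  encState .fin (2 ^ (pivots (litBits ots)).length) (canon (pivots (litBits ots)) ots)

/-- **The renaming stage**: from the initial state (mode `sel`, one unit), after any number
`N ≥ rankPasses` of passes the state is `finalState`. [folklore] -/
theorem renFST_iterate_final {N : ℕ} (hN : rankPasses (litBits ots) ≤ N) :
    renFST.eval^[N] (encState .sel 1 (initBody ots)) = finalState ots := by
  have := renFST_iterate_pivotsAux ots _ [] 1 (rem_nil_le _) N hN
  simpa [finalState, pivots, initBody] using this

/-- **No intermediate state of the renaming stage is longer than the final state.** [folklore] -/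
theorem length_iterate_renFST_le (i : ℕ) :
    (renFST.eval^[i] (encState .sel 1 (initBody ots))).length ≤ (finalState ots).length := by
  have := length_iterate_pivotsAux_le ots _ [] 1 (rem_nil_le _) i
  simpa [finalState, pivots, initBody] using this

/-- Length of a token in a canonical body for `v` pivots: brackets `1`, a literal on the index
`b`: `|b| + v + 1`. [folklore] -/
def tokLen (v : ℕ) : OTok → ℕ
  | .br _ => 1
  | .lit b _ => b.length + v + 1

/-- Length of a canonical body. [folklore] -/
theorem length_encBody_canon (P : List (List Bool)) :
    (encBody (canon P ots)).length = (ots.map (tokLen P.length)).sum := by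
  induction ots with
  | nil => rfl
  | cons t ots ih =>
    cases t with
    | br k => cases k <;> simp [canon, encBody_cons, encTok, tokLen] at ih ⊢ <;> omega
    | lit b p => simp [canon, encBody_cons, encTok, tokLen, canonLit, length_canonCells] at ih ⊢; omega

/-- **Length of the final state.** [folklore] -/
theorem length_finalState :
    (finalState ots).length =
      1 + 2 ^ (pivots (litBits ots)).length + (ots.map (tokLen (pivots (litBits ots)).length)).sum := by
  simp [finalState, encState, length_encBody_canon]; ring

end Main

end Literature.Computability.FineGrained.BruteForce
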